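import Literature.IUT.HodgeArakelov.MonoThetaProjectiveNaturalSystemAtModelTate
import Literature.IUT.HodgeArakelov.ThetaEvaluationModelEvDecompPointMin
import Literature.IUT.HodgeArakelov.AbsTopMonoidsGenuineOfSettingPadicClosure
import Literature.IUT.HodgeArakelov.GaloisPairCyclotomesCor111AtModelTate
import Literature.AnabelianGeometry.EtaleTheta.SettingModelTateThetaTopology
import Literature.AnabelianGeometry.EtaleTheta.SettingModelTateCyclotomes
import HarnessLib

/-!
# [IUTchII] Cor. 1.12 (ii)∧(iii) — the model closer of record AT THE [EtTh] TATE MODEL `ThetaSetting.modelTate p`: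
# every L2-side binder, the L3 bundle, `IsEtThOrigin`, `Δ_Θ` compact, the base MLF `(k, ε)` and (H2) discharged
# (proof-only; D-0079 K-L6)

S. Mochizuki, *Inter-universal Teichmüller theory II*, kurims manuscript (Dec. 2020), Cor. 1.12 (ii), (iii) pp. 56–58,
Rmk. 1.4.1 (ii) p. 28, Prop. 1.5 (iii) p. 29 [claim: Mochizuki2012, status: disputed] (IUTchII §1 Cor 1.12, kurims
pp.56-58); S. Mochizuki, *The étale theta function …*, Publ. RIMS **45** (2009) [EtTh], §1 pp. 11–14, Def. 2.5 p. 39,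
Def. 2.7 p. 41, Def. 2.13 p. 46 (PRIMS PDF pages) [cite: MochizukiEtTh2009, Def 2.13 p.46].  Cell `abc-iut`, seat
abc-iut-w4-d043 (gen 7; lineage of record of the [IUTchII] Cor. 1.12 model chain: `ThetaEvaluationModelEv*`,
p417475 … p439820), D-0079 programme L-K, K-L6 slice «genuine-instance constructions at the [EtTh] models» (abc-iut-L6-lead
13:21:50Z), sequel — for the nodes **IUTchII:Cor1.12(ii)**, **IUTchII:Cor1.12(iii)** — of abc-iut-w5-d233's
`BadPlaceSettingAtModelTate` (p453435) and `MonoThetaProjectiveNaturalSystemAtModelTate` (p454733), whose carriers are consumed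
BY NAME.  PROOF-ONLY: no definition, no instance, no new named fact; nothing of the parents is restated.

STATE OF RECORD.  The closer of record `EtaleLevels.cor112_model_of_cyclotomeTower_decompPoint_min` (p439820) proves the
typed Cor. 1.12 (ii) (`Cor112_ii`) AND the typed Cor. 1.12 (iii) diagram (`MuXmuDiagram` with last arrow the genuine
`Ism(G)`-orbit) for the model theta-evaluation datum `Ev` of ONE [EtTh] §1 theta setting `D` with `D_{μ_-} := D_y`, over
the binders: the [EtTh] data `D, E, C, hC, hS, hl, hp2, hpl, hζ`, a compatible cyclotome family `mods/hmods`, a root cocycle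
`f/hf`, `h15`, `L`, `hZ`, `hO : IsEtThOrigin`, `hΔΘ : Δ_Θ compact`, the L3 bundle `gd`, the base MLF `k ⊆ ℚ̄_p` with
`ε : G_K ≅ Gal(ℚ̄_p/k)`, (H1) `hΔX`, (H2) `hq` — and the CUSTODY residuals ((R1) inversion data `α hover δ hδ hαα γ hγ hαγ
huniq`, (H1) `hcharY`, `Env`, the point data «`y = μ_-`» `y hy hDmu hfixD etaStd hmem hstd`, the coefficient half
`β hφ hβ hα`, the Prop. 2.2 (ii) translates `τ hτ hdesc hrev hfree`).

THIS FILE (`cor112_model_modelTate`).  At the Tate model `modelTate p = modelχq p 1 2` (`p` prime, `l` an odd prime with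
`4l ∣ p − 1`, a compatible cyclotome TOWER `τ` — DATA, inhabited: abc-iut-L2-t8 `modelχq_nonempty_cyclotomeTower`), over the
carriers of record of p453435/p454733 (the `inr`-section étale-theta datum carrying `η̈♯`, `X̲̲` with `Π^tp_X̲̲ = Huuχq`, the
empty cusp labelling, `mods := τ.modAll`, `hmods := τ.red_modAll`, root cocycle `f := rootLift C`), EVERY non-custody binder
of the closer is a theorem or a datum of the tree, consumed BY NAME: `hC` (`compat_modelχq`, abc-iut-f-149), `hS`
(`ThetaSetting.modelχq_sec2Hyps`, abc-iut-L2-t8), `hO`/`hYcl` (`modelχq_isEtThOrigin`, `hYcl_modelχq`, abc-iut-L2-t5), `h15`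
(`prop15iii_etaleThetaDataOfClass_etaDdχq`, abc-iut-L2-t6), `hζ`, `hp2`, `hpl` (abc-iut-w5-d233, from `4l ∣ p − 1`), `hf`
(`rootLift_mem_rootCocycles`, abc-iut-w5-d233), `hZ` (`ModelCyclotomes.nonempty_lDeltaQuot_rigidData_mulEquiv_zHat`), AND —
beyond the parents' list — `hΔΘ` (`isCompact_deltaTheta_modelχq`, abc-iut-L2-t8), the L3 bundle `gd`
(`nonempty_groupLevelData_modelχq`, abc-iut-L2-t5 / abc-iut-L3), the base MLF `k := K = ℚ_p ⊆ ℚ̄_p` with its extended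
absolute value and `ε := galoisEpsilonPadic` (`σ ↦ σ`, abc-iut-w5-d233 `TemperedCurve.mlfClosurePadic`, p431000; the
instantiation pattern of `ThetaEvaluationCor112iiiGenuineOwnField`), and (H2) `hq` (abc-iut-w4-d030's theorem `hq_setting_modelTate`, p456925: abc-iut-w5-d105's topological first
isomorphism theorem over the open augmentation of the tempered, Galois-countable `Π^tp_X` of the model).  What is LEFT is exactly the custody list, each binder NAMED in the
statement: (R1) `α hover δ hδ hαα γ hγ hαγ huniq` (GAP G-w4d010-2 (R1), abc-iut-w5-d072), (H1) `hcharY`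
(`PiYddCharacteristic`, F-2633 at the instance) and (H1) `hΔX`, the [IUTchII] Prop. 1.2 (i) output `Env` (DATA; inhabited at
this carrier by abc-iut-w5-d233's `nonempty_envOfGroup_modelTate`), the point data `y hy hDmu hfixD etaStd hmem hstd`
([SemiAnbd] Thm. 6.8 (iii) / [IUTchII] Cor. 2.4 (ii)(b)), `β hφ hβ hα`, the Prop. 2.2 (ii) translates `tr htr hdesc hrev
hfree` (abc-iut-w5-d187), and the isomorph `G` of `G_K`.  Conclusion VERBATIM that of p439820 at these data.

HONEST LABEL: `modelTate` is a SEMI-SYNTHETIC model of the typed [EtTh] §1 interface (not the tempered `π₁` of a curve):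
this is joint-satisfiability / non-vacuity evidence that the [EtTh]-, L3- and [AbsTopIII]-side binders of the Cor. 1.12 model
closer are realised TOGETHER at one genuine (non-toy) carrier, leaving only the named custody inputs; the [IUTchII] claim key
`Mochizuki2012` is DISPUTED (D-0012) and nothing of it is asserted; nothing of [EtTh] is asserted beyond the tree's proofs;
no side is taken on [IUTchIII] Cor. 3.12; typed ≠ proved; instantiated ≠ endorsed; nothing here says abc is proved or refuted.
-/

noncomputable section

namespace Literature.IUT.HodgeArakelov

open Literature.AnabelianGeometry.AbsoluteAnabelian
open Literature.AnabelianGeometry.EtaleTheta Literature.AnabelianGeometry.SemiGraphs CohomologySystemOfContH1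
open Literature.AnabelianGeometry.EtaleTheta.SettingModel
open Literature.NumberTheory.GaloisRepresentations
open scoped Literature.AnabelianGeometry.EtaleTheta

namespace ModelTateCarriers

variable (p : ℕ) [Fact p.Prime] (l : ℕ+) (hl : Odd (l : ℕ)) (hlp : (l : ℕ).Prime) (hdvd : 4 * (l : ℕ) ∣ p - 1)
  {Es : Set ℕ+} (τ : (ThetaSetting.modelχq p 1 2 even_two).CyclotomeTower l Es)

/-- **[IUTchII] Cor. 1.12 (ii) AND (iii) at the model `Π := Π^tp_X̲̲`, `D_{μ_-} := D_y`, AT THE [EtTh] TATE MODEL** —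
abc-iut-w4-d043's closer of record `EtaleLevels.cor112_model_of_cyclotomeTower_decompPoint_min` (p439820) over
abc-iut-w5-d233's carriers of record at `modelTate p = modelχq p 1 2` (cyclotome tower `τ`, root cocycle `rootLift C`):
the [EtTh] data and `hC hS hO h15 hζ hp2 hpl hf hZ`, `Δ_Θ` compact, the L3 bundle `gd`, the base MLF
`(k, ε) := (K = ℚ_p, σ ↦ σ)` and (H2) `hq` are ALL theorems / data of the tree (the `let`s); the `∀`-bound inputs are exactly
the custody residuals of p439820 ((R1) inversion data, (H1) `hcharY`/`hΔX`, `Env`, the point data «`y = μ_-`», `β hφ hβ hα`,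
the Prop. 2.2 (ii) translates, `G`).  Conclusion verbatim: a bijective change of coefficient cyclotome `cU` pinned by
`τ.modAll` such that the typed `Cor112_ii` holds for the model `Ev` AND the typed `(†μ, ×μ)` diagram over the fully genuine
[AbsTopIII]-output data `genuineOfModelIsm … mlfClosurePadic galoisEpsilonPadic` exists with last arrow the genuine
`Ism(G)`-orbit. [claim: Mochizuki2012, status: disputed] (IUTchII §1 Cor 1.12 (ii)(iii), kurims pp.56-58) -/
theorem cor112_model_modelTate :
    let hC := compat_modelχq p 1 2 even_two
    let hS := ThetaSetting.modelχq_sec2Hyps p 1 2 even_two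
    let K₀ := (kummerCoreχq p 1 2 even_two).toKummerDataOfSection SemidirectProduct.inr (continuous_inrχq p 1 2)
        (fun _ => rfl) (map_inr_GK_le_GtpY_modelχq' p 1 2 even_two) (map_inr_GKdd_le_GtpYdd_modelχq' p 1 2 even_two)
    let C := (K₀.etaleThetaDataOfClass (etaDdχq p 1 2 even_two)).doubleUnderlineχqOfEtaRes p 1 2 l hl
        (eta_res_etaDdχq p 1 2 even_two l hl)
    -- the ROOT COCYCLE of the `EtaleLevels` chain: abc-iut-L6-t1's one-root lift (abc-iut-w5-d233 `rootLift_mem_rootCocycles`)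
    let f := EtaleThetaDataOfSetting.rootLift C
    let hf : f ∈ C.rootCocycles hC := rootLift_mem_rootCocycles C hC
    let h15 : Literature.AnabelianGeometry.EtaleTheta.ThetaSetting.Prop15iii _ hC :=
      prop15iii_etaleThetaDataOfClass_etaDdχq p hC SemidirectProduct.inr
        (continuous_inrχq p 1 2) (fun _ => rfl) (map_inr_GK_le_GtpY_modelχq' p 1 2 even_two)
        (map_inr_GKdd_le_GtpYdd_modelχq' p 1 2 even_two)
    let L : C.CuspLabels := ⟨fun _ => ∅, fun _ => ∅, fun _ => rfl⟩
    let hO := ThetaSetting.modelχq_isEtThOrigin p 1 2 even_two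
    let hYcl := hYcl_modelχq p 1 2 even_two
    let hp2 := ne_two_of_four_mul_dvd_pred p l.pos hdvd
    let hpl := ne_of_four_mul_dvd_pred p l.pos hdvd
    let hζ := exists_isPrimitiveRoot_K_modelχq p 1 2 even_two l.pos hdvd
    let hZ : ∀ M : ℕ+, Nonempty (ModelCyclotomes.lDeltaQuot (C.rigidData (τ.modAll M) hC hS h15 L) ≃*
        Literature.IUT.HodgeTheaters.ZHat) := fun M =>
      ModelCyclotomes.nonempty_lDeltaQuot_rigidData_mulEquiv_zHat C (τ.modAll M) hC hS h15 L hO hYcl hlp.ne_zero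
    -- the generic instances of the Cor. 1.12 vocabulary, re-supplied at the (reducible) Tate-model carriers
    haveI : ((ThetaSetting.modelχq p 1 2 even_two).lDeltaTheta l).Normal := (ThetaSetting.modelχq p 1 2 even_two).lDeltaTheta_normal l
    haveI : IsMulCommutative ((ThetaSetting.modelχq p 1 2 even_two).lDeltaTheta l) :=
      EtaleThetaDataOfSetting.instIsMulCommutative_lDeltaTheta (D := ThetaSetting.modelχq p 1 2 even_two) l
    letI : MulDistribMulAction (EtaleThetaDataOfSetting.Pi C) (PadicAlgCl p)ˣ := EtaleThetaDataOfSetting.unitsAction C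
    -- the L3 parameter bundle «`Π^temp` tempered, temp-slim, Galois-countable» of `X_v` AT THE TATE MODEL (abc-iut-L3 / L2-t5)
    let gd : (ThetaSetting.modelχq p 1 2 even_two).toTemperedCurve.GroupLevelData := (nonempty_groupLevelData_modelχq p 1 2 even_two).some
    -- (H2) `Π/Δ ≅ G_K` at the `EtaleLevels` setting of the Tate model: abc-iut-w4-d030's THEOREM `hq_setting_modelTate` (p456925)
    let hq : Nonempty (TopGroup.quot (EtaleLevels.setting C hC hS hlp hp2 hpl hζ τ.modAll f hf).PiX
        (EtaleLevels.setting C hC hS hlp hp2 hpl hζ τ.modAll f hf).DeltaX ≃ₜ*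
        (EtaleLevels.setting C hC hS hlp hp2 hpl hζ τ.modAll f hf).Gk) :=
      hq_setting_modelTate p l hl hlp hdvd τ
    ∀ -- the RESIDUAL named inputs of the closer of record, VERBATIM (custody items; none discharged, none smuggled):
      -- (H1) `Π^tp_Ÿ̲̲` characteristic (F-2633 at the instance) and the [IUTchII] Prop. 1.2 (i) output `Env` (DATA, inhabited:
      -- abc-iut-w5-d233 `nonempty_envOfGroup_modelTate`)
      (hcharY : EtaleThetaDataOfSetting.PiYddCharacteristic C)
      (Env : EnvOfGroup (EtaleLevels.setting C hC hS hlp hp2 hpl hζ τ.modAll f hf)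
        (EtaleLevels.modelSystem C hC hS hlp hp2 hpl hζ τ.modAll f hf τ.red_modAll h15 L hZ).PiX)
      -- the model pointed inversion (abc-iut-w5-d072's `pointedInversionOfPair`): its named print inputs
      (α : (EtaleThetaDataOfSetting.Pi C) ≃ₜ* (EtaleThetaDataOfSetting.Pi C))
      (hover : ∀ x : EtaleThetaDataOfSetting.Pi C, Env.recon.projG (Env.isoX (α x)) = Env.recon.projG (Env.isoX x))
      (δ : EtaleThetaDataOfSetting.Pi C) (hδ : Env.recon.projG (Env.isoX δ) = 1)
      (hαα : ∀ x : EtaleThetaDataOfSetting.Pi C, α (α x) = δ * x * δ⁻¹)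
      (γ : EtaleThetaDataOfSetting.Pi C) (hγ : C.toLZ γ = Multiplicative.ofAdd 1)
      (hαγ : C.toLZ (α γ) = Multiplicative.ofAdd (-1))
      (huniq : ∀ κ : (EtaleThetaDataOfSetting.Pi C) ≃ₜ* (EtaleThetaDataOfSetting.Pi C),
        (∀ x, Env.recon.projG (Env.isoX (κ x)) = Env.recon.projG (Env.isoX x)) →
        (∃ δ' : EtaleThetaDataOfSetting.Pi C, Env.recon.projG (Env.isoX δ') = 1 ∧ ∀ x, κ (κ x) = δ' * x * δ'⁻¹) →
        (¬ ∃ δ' : EtaleThetaDataOfSetting.Pi C, Env.recon.projG (Env.isoX δ') = 1 ∧ ∀ x, κ x = δ' * x * δ'⁻¹) →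
          ∃ δ' : EtaleThetaDataOfSetting.Pi C, Env.recon.projG (Env.isoX δ') = 1 ∧ ∀ x, κ x = δ' * α x * δ'⁻¹)
      -- the L3 parameter bundle «`Π^temp` tempered, Galois-countable» of `X_v`, and the POINT: a non-cuspidal closed point `y` of
      -- the tree's tempered curve `X̲̲_v`, whose decomposition group `D_y ⊆ Π^tp_X̲̲` instantiates print's `D_{μ_-}`
      (y : (C.temperedCurveXuuOfLevelData hlp.ne_zero gd).Pt) (hy : ¬ (C.temperedCurveXuuOfLevelData hlp.ne_zero gd).IsCusp y)
      -- what «`y = μ_-`» means in print: `D_{μ_-} ⊆ Π_Ÿ(Π)`, fixed by `ι_Ÿ` up to `Δ`-conjugacy, standard type at `D_{μ_-}`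
      (hDmu : (((C.temperedCurveXuuOfLevelData hlp.ne_zero gd).decomp y : Subgroup (EtaleThetaDataOfSetting.Pi C))) ≤
        EtaleThetaDataOfSetting.PiYdd C)
      (hfixD : ∃ δ' : ↥(EtaleThetaDataOfSetting.PiYdd C), Env.recon.projG (Env.isoX (δ' : EtaleThetaDataOfSetting.Pi C)) = 1 ∧
        ∀ (d : EtaleThetaDataOfSetting.Pi C) (hd : d ∈ ((C.temperedCurveXuuOfLevelData hlp.ne_zero gd).decomp y)),
          ((EtaleThetaDataOfSetting.iotaYddOfAut C hcharY α ⟨d, hDmu hd⟩ :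
          EtaleThetaDataOfSetting.PiYdd C) : EtaleThetaDataOfSetting.Pi C) ∈
            (((C.temperedCurveXuuOfLevelData hlp.ne_zero gd).decomp y : Subgroup (EtaleThetaDataOfSetting.Pi C))).map
              (MulAut.conj ((δ' : EtaleThetaDataOfSetting.PiYdd C) : EtaleThetaDataOfSetting.Pi C)).toMonoidHom)
      (etaStd : (EtaleThetaDataOfSetting.coh C).H1 ⊤) (hmem : etaStd ∈ EtaleThetaDataOfSetting.orbitOne C hC)
      (hstd : (2 * (EtaleLevels.setting C hC hS hlp hp2 hpl hζ τ.modAll f hf).l) •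
        EtaleThetaDataOfSetting.resDmuOf C ((C.temperedCurveXuuOfLevelData hlp.ne_zero gd).decomp y) hDmu etaStd = 0)
      -- the coefficient half of the pair and its printed properties
      (β : (ThetaSetting.modelχq p 1 2 even_two).GtpTheta ≃ₜ* (ThetaSetting.modelχq p 1 2 even_two).GtpTheta)
      (hφ : ∀ g, β (EtaleThetaDataOfSetting.phi C g) = EtaleThetaDataOfSetting.phi C (α g))
      -- (H1) `Δ` characteristic, for the GENUINE [AbsTopIII]-output data over `(K, ℚ̄_p, ε = id)` (k, ε, (H2) hq DISCHARGED below)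
      (hΔX : ∀ φ : (EtaleLevels.setting C hC hS hlp hp2 hpl hζ τ.modAll f hf).PiX ≃ₜ* (EtaleLevels.setting C hC hS hlp hp2 hpl hζ τ.modAll f hf).PiX,
        (EtaleLevels.setting C hC hS hlp hp2 hpl hζ τ.modAll f hf).DeltaX.map φ.toMulEquiv.toMonoidHom =
          (EtaleLevels.setting C hC hS hlp hp2 hpl hζ τ.modAll f hf).DeltaX)
      (hα : ∀ x, EtaleThetaDataOfSetting.aug C (α x) = EtaleThetaDataOfSetting.aug C x)
      (hβ : ∀ a : (ThetaSetting.modelχq p 1 2 even_two).GtpTheta, a ∈ (ThetaSetting.modelχq p 1 2 even_two).lDeltaTheta l → β a = a)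
      (tr : ℤ → (EtaleThetaDataOfSetting.coh C).H1 ⊤) (htr : tr 0 = etaStd)
      (hdesc : ∀ o ∈ EtaleThetaDataOfSetting.orbitOne C hC,
        ∃ (n : ℤ) (c' : (EtaleThetaDataOfSetting.coh C).H1 ⊤), 2 • c' = 0 ∧ o = tr n + c')
      (hrev : ∀ n : ℤ, IsOfFinAddOrder (EtaleThetaDataOfSetting.pairRho C α β hφ (EtaleThetaDataOfSetting.mem_lDeltaTheta_iff_of_eq_self β hβ) (EtaleThetaDataOfSetting.mem_PiYdd_iff_of_piYddCharacteristic C hcharY α) (tr n) - tr (-n)))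
      (hfree : ∀ m n : ℤ, IsOfFinAddOrder (tr m - tr n) → m = n)
      (G : IsoClass (EtaleLevels.setting C hC hS hlp hp2 hpl hζ τ.modAll f hf).Gk),
      haveI := EtaleThetaDataOfSetting.finiteIndex_map_aug_decompPoint C hlp.ne_zero gd y
      ∃ cU : CyclotomeCoefficients (EtaleThetaDataOfSetting.phi C) ((ThetaSetting.modelχq p 1 2 even_two).lDeltaTheta l) (PadicAlgCl p)ˣ,
        Function.Bijective cU.hom ∧
        (∀ (ζ : Literature.AnabelianGeometry.EtaleTheta.cyclotome (PadicAlgCl p)ˣ) (M : ℕ+),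
          (((τ.modAll M).red (cU.hom ζ) : MuN p M) : (PadicAlgCl p)ˣ) = (ζ : ℕ+ → (PadicAlgCl p)ˣ) M) ∧
        Literature.IUT.HodgeArakelov.Cor112_ii
          (EtaleLevels.thetaEvaluation C hC hS hlp hp2 hpl hζ τ.modAll f hf τ.red_modAll h15 L hZ hcharY (EtaleLevels.bijective_rigidLimHom C hC hS hlp hp2 hpl hζ τ.modAll f hf τ.red_modAll h15 L hZ) Env
            (EtaleThetaDataOfSetting.pointedInversionOfPair C hC hS hcharY (EtaleLevels.setting C hC hS hlp hp2 hpl hζ τ.modAll f hf)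
              (ContinuousMulEquiv.refl _) rfl Env α hover δ hδ hαα γ hγ hαγ huniq ((C.temperedCurveXuuOfLevelData hlp.ne_zero gd).decomp y) hDmu hfixD etaStd hmem hstd)
            (LevelRetraction.ofAugmentation (EtaleThetaDataOfSetting.phi C) ((ThetaSetting.modelχq p 1 2 even_two).lDeltaTheta l)
              (EtaleThetaDataOfSetting.aug C) ((C.temperedCurveXuuOfLevelData hlp.ne_zero gd).decomp y) (EtaleThetaDataOfSetting.decompPoint_eq_one_of_aug_eq_one C hlp.ne_zero gd y hy) (EtaleThetaDataOfSetting.PiYdd C)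
              (EtaleThetaDataOfSetting.continuous_aug C) (EtaleLevels.aug_ker_acts_trivially C)
              (hlift_of_isCompact (EtaleThetaDataOfSetting.aug C) ((C.temperedCurveXuuOfLevelData hlp.ne_zero gd).decomp y) (EtaleThetaDataOfSetting.continuous_aug C) (EtaleThetaDataOfSetting.isCompact_decompPoint C hlp.ne_zero gd y))
              (hemb_of_isCompact (EtaleThetaDataOfSetting.aug C) ((C.temperedCurveXuuOfLevelData hlp.ne_zero gd).decomp y) (EtaleThetaDataOfSetting.continuous_aug C) (EtaleThetaDataOfSetting.isCompact_decompPoint C hlp.ne_zero gd y) (EtaleThetaDataOfSetting.decompPoint_eq_one_of_aug_eq_one C hlp.ne_zero gd y hy)))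
            cU (EtaleThetaDataOfSetting.isOpen_stabilizer_units C) (EtaleThetaDataOfSetting.finiteIndex_stabilizer_units C)
            (unitGroup ℚ_[p] (PadicAlgCl p)) (EtaleThetaDataOfSetting.pairRhoLim C α β hφ (EtaleThetaDataOfSetting.mem_lDeltaTheta_iff_of_eq_self β hβ) (EtaleThetaDataOfSetting.mem_PiYdd_iff_of_piYddCharacteristic C hcharY α))) ∧
        ∃ Δ : MuXmuDiagram
            (EtaleLevels.thetaEvaluation C hC hS hlp hp2 hpl hζ τ.modAll f hf τ.red_modAll h15 L hZ hcharY (EtaleLevels.bijective_rigidLimHom C hC hS hlp hp2 hpl hζ τ.modAll f hf τ.red_modAll h15 L hZ) Env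
              (EtaleThetaDataOfSetting.pointedInversionOfPair C hC hS hcharY (EtaleLevels.setting C hC hS hlp hp2 hpl hζ τ.modAll f hf)
                (ContinuousMulEquiv.refl _) rfl Env α hover δ hδ hαα γ hγ hαγ huniq ((C.temperedCurveXuuOfLevelData hlp.ne_zero gd).decomp y) hDmu hfixD etaStd hmem hstd)
              (LevelRetraction.ofAugmentation (EtaleThetaDataOfSetting.phi C) ((ThetaSetting.modelχq p 1 2 even_two).lDeltaTheta l)
                (EtaleThetaDataOfSetting.aug C) ((C.temperedCurveXuuOfLevelData hlp.ne_zero gd).decomp y) (EtaleThetaDataOfSetting.decompPoint_eq_one_of_aug_eq_one C hlp.ne_zero gd y hy) (EtaleThetaDataOfSetting.PiYdd C)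
                (EtaleThetaDataOfSetting.continuous_aug C) (EtaleLevels.aug_ker_acts_trivially C)
                (hlift_of_isCompact (EtaleThetaDataOfSetting.aug C) ((C.temperedCurveXuuOfLevelData hlp.ne_zero gd).decomp y) (EtaleThetaDataOfSetting.continuous_aug C) (EtaleThetaDataOfSetting.isCompact_decompPoint C hlp.ne_zero gd y))
                (hemb_of_isCompact (EtaleThetaDataOfSetting.aug C) ((C.temperedCurveXuuOfLevelData hlp.ne_zero gd).decomp y) (EtaleThetaDataOfSetting.continuous_aug C) (EtaleThetaDataOfSetting.isCompact_decompPoint C hlp.ne_zero gd y) (EtaleThetaDataOfSetting.decompPoint_eq_one_of_aug_eq_one C hlp.ne_zero gd y hy)))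
              cU (EtaleThetaDataOfSetting.isOpen_stabilizer_units C) (EtaleThetaDataOfSetting.finiteIndex_stabilizer_units C)
              (unitGroup ℚ_[p] (PadicAlgCl p)) (EtaleThetaDataOfSetting.pairRhoLim C α β hφ (EtaleThetaDataOfSetting.mem_lDeltaTheta_iff_of_eq_self β hβ) (EtaleThetaDataOfSetting.mem_PiYdd_iff_of_piYddCharacteristic C hcharY α)))
            (AbsTopMonoids.genuineOfModelIsm (EtaleLevels.setting C hC hS hlp hp2 hpl hζ τ.modAll f hf) (ThetaSetting.modelχq p 1 2 even_two).toTemperedCurve.mlfClosurePadic (ThetaSetting.modelχq p 1 2 even_two).toTemperedCurve.galoisEpsilonPadic hΔX hq) G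
            ↥(AddCommGroup.torsion (EtaleLevels.thetaEnvData C hC hS hlp hp2 hpl hζ τ.modAll f hf τ.red_modAll h15 L hZ hcharY (EtaleLevels.bijective_rigidLimHom C hC hS hlp hp2 hpl hζ τ.modAll f hf τ.red_modAll h15 L hZ)).cohEnv.lim)
            (AddCommGroup.torsion (EtaleLevels.thetaEnvData C hC hS hlp hp2 hpl hζ τ.modAll f hf τ.red_modAll h15 L hZ hcharY (EtaleLevels.bijective_rigidLimHom C hC hS hlp hp2 hpl hζ τ.modAll f hf τ.red_modAll h15 L hZ)).cohEnv.lim).subtype,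
          Δ.poly₄₅ = {e | ∃ (φ : AbsTopMonoids.Genuine.qObj hq (IsoClass.base (EtaleLevels.setting C hC hS hlp hp2 hpl hζ τ.modAll f hf).PiX) ⟶ G)
              (gI : (AbsTopMonoids.genuineOfModelIsm (EtaleLevels.setting C hC hS hlp hp2 hpl hζ τ.modAll f hf) (ThetaSetting.modelχq p 1 2 even_two).toTemperedCurve.mlfClosurePadic
                (ThetaSetting.modelχq p 1 2 even_two).toTemperedCurve.galoisEpsilonPadic hΔX hq).Ism G),
            ∀ (u : ↥(unitGroup ℚ_[p] (PadicAlgCl p)))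
              (m : ↥(EtaleLevels.thetaEvaluation C hC hS hlp hp2 hpl hζ τ.modAll f hf τ.red_modAll h15 L hZ hcharY (EtaleLevels.bijective_rigidLimHom C hC hS hlp hp2 hpl hζ τ.modAll f hf τ.red_modAll h15 L hZ) Env
                (EtaleThetaDataOfSetting.pointedInversionOfPair C hC hS hcharY (EtaleLevels.setting C hC hS hlp hp2 hpl hζ τ.modAll f hf)
                  (ContinuousMulEquiv.refl _) rfl Env α hover δ hδ hαα γ hγ hαγ huniq ((C.temperedCurveXuuOfLevelData hlp.ne_zero gd).decomp y) hDmu hfixD etaStd hmem hstd)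
                (LevelRetraction.ofAugmentation (EtaleThetaDataOfSetting.phi C) ((ThetaSetting.modelχq p 1 2 even_two).lDeltaTheta l)
                  (EtaleThetaDataOfSetting.aug C) ((C.temperedCurveXuuOfLevelData hlp.ne_zero gd).decomp y) (EtaleThetaDataOfSetting.decompPoint_eq_one_of_aug_eq_one C hlp.ne_zero gd y hy) (EtaleThetaDataOfSetting.PiYdd C)
                  (EtaleThetaDataOfSetting.continuous_aug C) (EtaleLevels.aug_ker_acts_trivially C)
                  (hlift_of_isCompact (EtaleThetaDataOfSetting.aug C) ((C.temperedCurveXuuOfLevelData hlp.ne_zero gd).decomp y) (EtaleThetaDataOfSetting.continuous_aug C) (EtaleThetaDataOfSetting.isCompact_decompPoint C hlp.ne_zero gd y))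
                  (hemb_of_isCompact (EtaleThetaDataOfSetting.aug C) ((C.temperedCurveXuuOfLevelData hlp.ne_zero gd).decomp y) (EtaleThetaDataOfSetting.continuous_aug C) (EtaleThetaDataOfSetting.isCompact_decompPoint C hlp.ne_zero gd y) (EtaleThetaDataOfSetting.decompPoint_eq_one_of_aug_eq_one C hlp.ne_zero gd y hy)))
                cU (EtaleThetaDataOfSetting.isOpen_stabilizer_units C) (EtaleThetaDataOfSetting.finiteIndex_stabilizer_units C)
                (unitGroup ℚ_[p] (PadicAlgCl p)) (EtaleThetaDataOfSetting.pairRhoLim C α β hφ (EtaleThetaDataOfSetting.mem_lDeltaTheta_iff_of_eq_self β hβ) (EtaleThetaDataOfSetting.mem_PiYdd_iff_of_piYddCharacteristic C hcharY α))).MxTM)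
              (w : (nonzeroIntegers (ThetaSetting.modelχq p 1 2 even_two).toTemperedCurve.mlfClosurePadic.k (ThetaSetting.modelχq p 1 2 even_two).toTemperedCurve.mlfClosurePadic.K)ˣ),
              (m : (EtaleLevels.thetaEvaluation C hC hS hlp hp2 hpl hζ τ.modAll f hf τ.red_modAll h15 L hZ hcharY (EtaleLevels.bijective_rigidLimHom C hC hS hlp hp2 hpl hζ τ.modAll f hf τ.red_modAll h15 L hZ) Env
                (EtaleThetaDataOfSetting.pointedInversionOfPair C hC hS hcharY (EtaleLevels.setting C hC hS hlp hp2 hpl hζ τ.modAll f hf)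
                  (ContinuousMulEquiv.refl _) rfl Env α hover δ hδ hαα γ hγ hαγ huniq ((C.temperedCurveXuuOfLevelData hlp.ne_zero gd).decomp y) hDmu hfixD etaStd hmem hstd)
                (LevelRetraction.ofAugmentation (EtaleThetaDataOfSetting.phi C) ((ThetaSetting.modelχq p 1 2 even_two).lDeltaTheta l)
                  (EtaleThetaDataOfSetting.aug C) ((C.temperedCurveXuuOfLevelData hlp.ne_zero gd).decomp y) (EtaleThetaDataOfSetting.decompPoint_eq_one_of_aug_eq_one C hlp.ne_zero gd y hy) (EtaleThetaDataOfSetting.PiYdd C)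
                  (EtaleThetaDataOfSetting.continuous_aug C) (EtaleLevels.aug_ker_acts_trivially C)
                  (hlift_of_isCompact (EtaleThetaDataOfSetting.aug C) ((C.temperedCurveXuuOfLevelData hlp.ne_zero gd).decomp y) (EtaleThetaDataOfSetting.continuous_aug C) (EtaleThetaDataOfSetting.isCompact_decompPoint C hlp.ne_zero gd y))
                  (hemb_of_isCompact (EtaleThetaDataOfSetting.aug C) ((C.temperedCurveXuuOfLevelData hlp.ne_zero gd).decomp y) (EtaleThetaDataOfSetting.continuous_aug C) (EtaleThetaDataOfSetting.isCompact_decompPoint C hlp.ne_zero gd y) (EtaleThetaDataOfSetting.decompPoint_eq_one_of_aug_eq_one C hlp.ne_zero gd y hy)))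
                cU (EtaleThetaDataOfSetting.isOpen_stabilizer_units C) (EtaleThetaDataOfSetting.finiteIndex_stabilizer_units C)
                (unitGroup ℚ_[p] (PadicAlgCl p)) (EtaleThetaDataOfSetting.pairRhoLim C α β hφ (EtaleThetaDataOfSetting.mem_lDeltaTheta_iff_of_eq_self β hβ) (EtaleThetaDataOfSetting.mem_PiYdd_iff_of_piYddCharacteristic C hcharY α))).Hd) =
                  Multiplicative.toAdd (h1LimKummer (EtaleThetaDataOfSetting.phi C) ((ThetaSetting.modelχq p 1 2 even_two).lDeltaTheta l) ((C.temperedCurveXuuOfLevelData hlp.ne_zero gd).decomp y) cU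
                    (EtaleThetaDataOfSetting.isOpen_stabilizer_units C) (EtaleThetaDataOfSetting.finiteIndex_stabilizer_units C) u) →
              ((w : nonzeroIntegers (ThetaSetting.modelχq p 1 2 even_two).toTemperedCurve.mlfClosurePadic.k (ThetaSetting.modelχq p 1 2 even_two).toTemperedCurve.mlfClosurePadic.K) :
                  (ThetaSetting.modelχq p 1 2 even_two).toTemperedCurve.mlfClosurePadic.K) = ((u : (PadicAlgCl p)ˣ) : PadicAlgCl p) →
                e (Multiplicative.ofAdd (QuotientAddGroup.mk m)) =
                  (AbsTopMonoids.genuineOfModelIsm (EtaleLevels.setting C hC hS hlp hp2 hpl hζ τ.modAll f hf) (ThetaSetting.modelχq p 1 2 even_two).toTemperedCurve.mlfClosurePadic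
                      (ThetaSetting.modelχq p 1 2 even_two).toTemperedCurve.galoisEpsilonPadic hΔX hq).actIsm G gI
                    (QuotientGroup.mk (Units.map (AbsTopMonoids.Genuine.liftM (ThetaSetting.modelχq p 1 2 even_two).toTemperedCurve.mlfClosurePadic
                      (AbsTopMonoids.Genuine.phiOf (ThetaSetting.modelχq p 1 2 even_two).toTemperedCurve.mlfClosurePadic (ThetaSetting.modelχq p 1 2 even_two).toTemperedCurve.galoisEpsilonPadic φ)).toMonoidHom w))} := by
  intro hC hS K₀ C f hf h15 L hO hYcl hp2 hpl hζ hZ gd hq hcharY Env α hover δ hδ hαα γ hγ hαγ huniq y hy hDmu hfixD etaStd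
    hmem hstd β hφ hΔX hα hβ tr htr hdesc hrev hfree G
  letI : IsNonarchimedeanLocalField ℚ_[p] := Padic.isNonarchimedeanLocalField_holds p
  haveI : FiniteDimensional ℚ_[p] (ThetaSetting.modelχq p 1 2 even_two).K :=
    (ThetaSetting.modelχq p 1 2 even_two).finiteDimensional_K
  haveI : ((ThetaSetting.modelχq p 1 2 even_two).lDeltaTheta l).Normal :=
    (ThetaSetting.modelχq p 1 2 even_two).lDeltaTheta_normal l
  haveI : IsMulCommutative ((ThetaSetting.modelχq p 1 2 even_two).lDeltaTheta l) :=
    EtaleThetaDataOfSetting.instIsMulCommutative_lDeltaTheta (D := ThetaSetting.modelχq p 1 2 even_two) l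
  letI : MulDistribMulAction (EtaleThetaDataOfSetting.Pi C) (PadicAlgCl p)ˣ := EtaleThetaDataOfSetting.unitsAction C
  -- the closer of record, every local-field / closure instance of `K = ℚ_p ⊆ ℚ̄_p` passed EXPLICITLY
  exact @EtaleLevels.cor112_model_of_cyclotomeTower_decompPoint_min p _ (ThetaSetting.modelχq p 1 2 even_two) _ _ C hC hS
    hlp hp2 hpl hζ τ.modAll f hf τ.red_modAll h15 L hZ hcharY Env α hover δ hδ hαα γ hγ hαγ huniq gd y hy hDmu hfixD etaStd
    hmem hstd β hφ (↥(ThetaSetting.modelχq p 1 2 even_two).K) _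
    (FiniteExtension.valuativeRel ℚ_[p] (ThetaSetting.modelχq p 1 2 even_two).K)
    (FiniteExtension.topologicalSpace ℚ_[p] (ThetaSetting.modelχq p 1 2 even_two).K)
    (FiniteExtension.isNonarchimedeanLocalField ℚ_[p] (ThetaSetting.modelχq p 1 2 even_two).K)
    (charZero_of_injective_algebraMap (algebraMap ℚ_[p] (ThetaSetting.modelχq p 1 2 even_two).K).injective) _
    (Literature.FieldTheory.Galois.isAlgClosure_of_intermediateField (ThetaSetting.modelχq p 1 2 even_two).K) _
    (ThetaSetting.modelχq p 1 2 even_two).finiteDimensional_K _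
    (ThetaSetting.modelχq p 1 2 even_two).toTemperedCurve.galoisEpsilonPadic hΔX hq hO
    (isCompact_deltaTheta_modelχq p 1 2 even_two) hα hβ tr htr hdesc hrev hfree G

end ModelTateCarriers

end Literature.IUT.HodgeArakelov

end
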